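import Mathlib
import Summits.Ventures.PercRepro.PuncturedLYMCapPeelMain
import Summits.Ventures.PercRepro.PuncturedLYMCapAssembly

/-!
# PercRepro — THE VALUE-BLOCK PIPELINE: (SP) FROM A β-TABLE
(p10, gen 42)

A β-TABLE `βt S 𝒞 l w a γ c` assigns the removal probability of the stage `(S, 𝒞, l, w, a, γ)` to the block size `c`.
`CapOK m βt w S 𝒞 l a γ R` says, by recursion on the cap `w`, that the table is admissible on every stage reached from
`(S, 𝒞, l, w, a, γ, R)`: at cap `0` the LEAF IDENTITY `R = a·(#F − l)/(l+1) + γ·#𝒞` (`F = S ∖ ⋃𝒞` the free part); at cap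
`w + 1` the table is `0` at `0`, lies in `[0, 1]`, is `1` on the all-block columns, and the inner stage of every block `B` is
admissible with the handed-down parameters `a·(1 − β #B)`, `γ' #B = (m − w)·a·β(#B + 1)/((#B + 1)(w + 1))`, `R − γ·#B`.
**`hasFlow_cap_of_ok`**: an admissible table gives the flow of the cap instance (`isFlow_capPeel` iterated, `isFlow_cap0` at
the bottom); **`hasFlow_sp_of_ok`**: (SP)_1 on `(S, l, 𝒞)` from an admissible table at cap `m − 1` with discount `1/m`;
**`puncturedNMP_of_ok`**: (SP) of a pairwise disjoint family on the whole type from an admissible table — the count identity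
`R·#P = #Y` being forced by the flow (`sum_row_eq_sum_col`).  So (SP) for a pattern reduces to the positivity of its
β-table on the reached stages and the leaf identities — no linear algebra, no per-class identities (paper
proofs/P10-PEEL-g42.md §5).  Nothing here asserts (SP).
-/

namespace PercRepro.PuncturedLYM.Split.Peel

open Finset

variable {α : Type} [DecidableEq α]

/-- The admissibility of a β-table along the value-block recursion (see the module docstring). -/
def CapOK (m : ℕ) (βt : Finset α → Finset (Finset α) → ℕ → ℕ → ℚ → ℚ → ℕ → ℚ) :
    ℕ → Finset α → Finset (Finset α) → ℕ → ℚ → ℚ → ℚ → Prop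
  | 0, S, 𝒞, l, a, γ, R => R = a * (((S \ blockUnion 𝒞).card - l : ℕ) : ℚ) / ((l : ℚ) + 1) + γ * 𝒞.card
  | w + 1, S, 𝒞, l, a, γ, R =>
      βt S 𝒞 l (w + 1) a γ 0 = 0 ∧ (∀ c, 0 ≤ βt S 𝒞 l (w + 1) a γ c ∧ βt S 𝒞 l (w + 1) a γ c ≤ 1) ∧
      (∀ c, (w + 1) * c = l + 1 → βt S 𝒞 l (w + 1) a γ c = 1) ∧
      ∀ B : Finset (Finset α), B ⊆ 𝒞 → (w + 1) * B.card ≤ l →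
        CapOK m βt w (S \ blockUnion B) (𝒞 \ B) (l - (w + 1) * B.card)
          (a * (1 - βt S 𝒞 l (w + 1) a γ B.card))
          (((m : ℚ) - (w + 1 : ℕ) + 1) * a * βt S 𝒞 l (w + 1) a γ (B.card + 1) / (((B.card : ℚ) + 1) * (w + 1 : ℕ)))
          (R - γ * B.card)

/-- **THE CAP FLOW FROM AN ADMISSIBLE TABLE.** -/
theorem hasFlow_cap_of_ok {m : ℕ} (βt : Finset α → Finset (Finset α) → ℕ → ℕ → ℚ → ℚ → ℕ → ℚ) :
    ∀ (w : ℕ) (S : Finset α) (𝒞 : Finset (Finset α)) (l : ℕ) (a γ R : ℚ),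
      (∀ C ∈ 𝒞, C ⊆ S) → (∀ C ∈ 𝒞, C.card = m) → (∀ C ∈ 𝒞, ∀ C' ∈ 𝒞, C ≠ C' → Disjoint C C') →
      w < m → 0 ≤ a → CapOK m βt w S 𝒞 l a γ R →
      HasFlow S l (rowsCap S l 𝒞 w) (fun X => R - γ * rcount 𝒞 w X)
        (fun Y => if ∀ C ∈ 𝒞, (Y ∩ C).card ≤ w then a else 0) := by
  intro w
  induction w with
  | zero =>
    intro S 𝒞 l a γ R _ _ _ _ ha hok
    simp only [CapOK] at hok
    refine ⟨cap0Weight S 𝒞 l a, ?_⟩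
    rw [hok]
    exact isFlow_cap0 ha
  | succ w ih =>
    intro S 𝒞 l a γ R h𝒞S hcard hdisj hwm ha hok
    obtain ⟨hβ0, hβ, hβtop, hinnerOK⟩ := hok
    -- the inner flows of the blocks, by the induction hypothesis
    have hinner : ∀ B : Finset (Finset α), B ⊆ 𝒞 ∧ (w + 1) * B.card ≤ l →
        HasFlow (S \ blockUnion B) (l - (w + 1) * B.card)
          (rowsCap (S \ blockUnion B) (l - (w + 1) * B.card) (𝒞 \ B) w)
          (fun X' => (R - γ * B.card) - (((m : ℚ) - (w + 1 : ℕ) + 1) * a * βt S 𝒞 l (w + 1) a γ (B.card + 1)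
            / (((B.card : ℚ) + 1) * (w + 1 : ℕ))) * rcount (𝒞 \ B) w X')
          (fun Y' => if ∀ C ∈ 𝒞 \ B, (Y' ∩ C).card ≤ w then a * (1 - βt S 𝒞 l (w + 1) a γ B.card) else 0) := by
      rintro B ⟨hB, hBl⟩
      apply ih
      · intro C hC
        obtain ⟨hC𝒞, hCB⟩ := mem_sdiff.1 hC
        exact subset_sdiff.2 ⟨h𝒞S C hC𝒞, disjoint_blockUnion_of_notMem hdisj hB hC𝒞 hCB⟩
      · exact fun C hC => hcard C (mem_sdiff.1 hC).1
      · exact fun C hC C' hC' hne => hdisj C (mem_sdiff.1 hC).1 C' (mem_sdiff.1 hC').1 hne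
      · omega
      · exact mul_nonneg ha (by linarith [(hβ B.card).2])
      · exact hinnerOK B hB hBl
    choose w' hw' using hinner
    let w'' : Finset (Finset α) → Finset α → Finset α → ℚ := fun B =>
      if h : B ⊆ 𝒞 ∧ (w + 1) * B.card ≤ l then w' B h else fun _ _ => 0
    have hw''nn : ∀ B X Y, 0 ≤ w'' B X Y := by
      intro B X Y
      simp only [w'']
      split_ifs with h
      · exact (hw' B h).nonneg X Y
      · exact le_refl 0
    refine ⟨capWeight 𝒞 (w + 1) a (βt S 𝒞 l (w + 1) a γ) w'', ?_⟩
    have hflow := isFlow_capPeel (S := S) h𝒞S hcard hdisj (w := w + 1) (by omega) hwm (l := l) ha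
      (β := βt S 𝒞 l (w + 1) a γ) hβ0 hβ hβtop (γ := γ) (R := R)
      (γ' := fun c => ((m : ℚ) - (w + 1 : ℕ) + 1) * a * βt S 𝒞 l (w + 1) a γ (c + 1) / (((c : ℚ) + 1) * (w + 1 : ℕ)))
      (R' := fun c => R - γ * c) (fun c => by push_cast; ring) (fun c => rfl) (w' := w'') hw''nn ?_
    · exact hflow
    · intro B hB hBl
      have hh : B ⊆ 𝒞 ∧ (w + 1) * B.card ≤ l := ⟨hB, hBl⟩
      have heq : w'' B = w' B hh := by simp only [w'', dif_pos hh]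
      rw [heq]
      have := hw' B hh
      simpa using this

/-- **(SP)_1 FROM AN ADMISSIBLE TABLE AT CAP `m − 1` WITH DISCOUNT `1/m`.** -/
theorem hasFlow_sp_of_ok {m : ℕ} (βt : Finset α → Finset (Finset α) → ℕ → ℕ → ℚ → ℚ → ℕ → ℚ)
    {S : Finset α} {𝒞 : Finset (Finset α)} (h𝒞S : ∀ C ∈ 𝒞, C ⊆ S) (hm : 0 < m)
    (hcard : ∀ C ∈ 𝒞, C.card = m) (hdisj : ∀ C ∈ 𝒞, ∀ C' ∈ 𝒞, C ≠ C' → Disjoint C C') {l : ℕ}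
    (hl : l + 1 < 2 * m) {R : ℚ} (hok : CapOK m βt (m - 1) S 𝒞 l 1 (1 / (m : ℚ)) R) :
    HasFlow S l (rowsOf S l 𝒞) (fun _ => R) (colMass 𝒞 1) :=
  hasFlow_sp_of_cap h𝒞S hm hcard hdisj hl
    (hasFlow_cap_of_ok βt (m - 1) S 𝒞 l 1 (1 / (m : ℚ)) R h𝒞S hcard hdisj (by omega) zero_le_one hok)

/-! ### The count identity forced by a flow, and the bridge to the tree -/

/-- The supersets of a row are the columns containing it. -/
theorem sups_eq_filter_cols {S X : Finset α} {l : ℕ} (hXS : X ⊆ S) (hXc : X.card = l) :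
    sups S X = (cols S l).filter (fun Y => X ⊆ Y) := by
  ext Y
  rw [mem_sups, mem_filter, mem_cols]
  constructor
  · rintro ⟨y, hyS, hyX, rfl⟩
    exact ⟨⟨insert_subset hyS hXS, by rw [card_insert_of_notMem hyX, hXc]⟩, subset_insert y X⟩
  · rintro ⟨⟨hYS, hYc⟩, hXY⟩
    obtain ⟨y, hyY, rfl⟩ := eq_erase_of_subset_of_card hXY (by omega)
    refine ⟨y, hYS hyY, notMem_erase y Y, ?_⟩
    rw [insert_erase hyY]

/-- The total of the row sums of a flow is the total of its column sums. -/
theorem sum_row_eq_sum_col {S : Finset α} {l : ℕ} {P : Finset (Finset α)} (hP : P ⊆ S.powersetCard l)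
    {ρ ν : Finset α → ℚ} {w : Finset α → Finset α → ℚ} (hw : IsFlow S l P ρ ν w) :
    ∑ X ∈ P, ρ X = ∑ Y ∈ cols S l, ν Y := by
  have h1 : ∑ X ∈ P, ρ X = ∑ X ∈ P, ∑ Y ∈ (cols S l).filter (fun Y => X ⊆ Y), w X Y := by
    apply sum_congr rfl
    intro X hX
    obtain ⟨hXS, hXc⟩ := mem_powersetCard.1 (hP hX)
    rw [← hw.row X hX, sups_eq_filter_cols hXS hXc]
  have h2 : ∑ Y ∈ cols S l, ν Y = ∑ Y ∈ cols S l, ∑ X ∈ P.filter (fun X => X ⊆ Y), w X Y := by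
    apply sum_congr rfl
    intro Y hY
    rw [← hw.col Y hY]
    rfl
  rw [h1, h2]
  exact sum_comm' (fun X Y => by
    simp only [mem_filter]
    tauto)

/-- **(SP) OF A PAIRWISE DISJOINT FAMILY ON THE WHOLE TYPE FROM AN ADMISSIBLE β-TABLE.** -/
theorem puncturedNMP_of_ok [Fintype α] {m : ℕ} (βt : Finset α → Finset (Finset α) → ℕ → ℕ → ℚ → ℚ → ℕ → ℚ)
    {k : ℕ} (C : Fin k → Finset α) (hm : 0 < m) (hcard : ∀ i, (C i).card = m)
    (hdisj : ∀ i j, i ≠ j → Disjoint (C i) (C j)) {l : ℕ} (hl : l + 1 < 2 * m) {R : ℚ}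
    (hok : CapOK m βt (m - 1) univ ((univ : Finset (Fin k)).image C) l 1 (1 / (m : ℚ)) R) :
    PuncturedNMP l ((univ : Finset (Fin k)).biUnion (fun i => upLevel l (C i))) := by
  set 𝒞 := (univ : Finset (Fin k)).image C with h𝒞
  have hcard' : ∀ C' ∈ 𝒞, C'.card = m := by
    intro C' hC'
    obtain ⟨i, _, rfl⟩ := mem_image.1 hC'
    exact hcard i
  have hdisj' : ∀ C' ∈ 𝒞, ∀ C'' ∈ 𝒞, C' ≠ C'' → Disjoint C' C'' := by
    intro C' hC' C'' hC'' hne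
    obtain ⟨i, _, rfl⟩ := mem_image.1 hC'
    obtain ⟨j, _, rfl⟩ := mem_image.1 hC''
    exact hdisj i j (fun h => hne (h ▸ rfl))
  have hflow := hasFlow_sp_of_ok βt (fun _ _ => subset_univ _) hm hcard' hdisj' hl hok
  obtain ⟨w, hw⟩ := hflow
  have hrows : rowsOf univ l 𝒞 = punctured l ((univ : Finset (Fin k)).biUnion (fun i => upLevel l (C i))) :=
    rowsOf_univ_eq_punctured C
  have hcolsU : cols univ l = levelAbove α l := rfl
  -- the count identity `R · #P = #Y`
  have hcount := sum_row_eq_sum_col (P := rowsOf univ l 𝒞)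
    (fun X hX => mem_powersetCard.2 ⟨(mem_rowsOf.1 hX).1, (mem_rowsOf.1 hX).2.1⟩) hw
  have hcol1 : ∀ Y ∈ cols univ l, colMass 𝒞 1 Y = 1 := by
    intro Y _; unfold colMass; split_ifs <;> rfl
  rw [sum_congr rfl hcol1] at hcount
  simp only [sum_const, nsmul_eq_mul, mul_one] at hcount
  rw [hcolsU] at hcount
  rcases Nat.eq_zero_or_pos (levelAbove α l).card with hY0 | hYpos
  · -- no columns at all: (SP) is trivial
    intro 𝒜 _
    rw [hY0, Nat.mul_zero]
    exact Nat.zero_le _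
  · apply puncturedNMP_of_hasFlow
    rw [← hrows]
    have hYq : (0 : ℚ) < (levelAbove α l).card := by exact_mod_cast hYpos
    have hPpos : (0 : ℚ) < (rowsOf univ l 𝒞).card := by
      by_contra h
      have h' : ((rowsOf univ l 𝒞).card : ℚ) = 0 := le_antisymm (not_lt.1 h) (Nat.cast_nonneg _)
      rw [h', zero_mul] at hcount
      exact hYq.ne' hcount.symm
    refine ⟨fun X Y => w X Y / (levelAbove α l).card, fun X Y => div_nonneg (hw.nonneg X Y) hYq.le, ?_, ?_⟩
    · intro X hX
      rw [← sum_div, hw.row X hX, div_eq_div_iff hYq.ne' hPpos.ne', one_mul, mul_comm]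
      exact hcount
    · intro Y hY
      rw [← sum_div, hw.col Y hY, hcol1 Y hY]

end PercRepro.PuncturedLYM.Split.Peel
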